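import Literature.NumberTheory.Automorphic.AutomorphicRepsGLIrreducibleL2Proofs
import Literature.NumberTheory.Automorphic.AutomorphicFormsL2Derivative
import Literature.NumberTheory.Automorphic.OneParameterClosureInvariant
import Literature.NumberTheory.Automorphic.AutomorphicFormsSpan
import HarnessLib

/-!
# Realisation of irreducible spaces of cusp forms on `GL_n` in `L²_cusp`, second layer: the two
# Harish-Chandra facts reduced to analyticity of orbits and to the `K`-finite vectors

Topic `NumberTheory/Automorphic`; sequel to `AutomorphicRepsGLIrreducibleL2Proofs`, which proves
the named fact `AutomorphicRepsGL.exists_le_formsOfL2_of_W'_eq_bot hcpt μ` of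
`AutomorphicRepsGLIrreducibleL2` (an irreducible stable space `W` of `A_G`-invariant cusp forms
on `GL_n(𝔸_K)` lies in `V_Π` for an irreducible closed invariant `Π ≤ L²_cusp`) from boundedness
(`cuspidal_bounded`, Getz–Hahn Thm. 9.8.1), `mem_automorphicForms_iff` (Borel–Jacquet 4.3) and
two named facts of Harish-Chandra type: `cuspidal_closure_exp_invariant` (the closure of the
classes `[W]` is invariant under `R(exp X)`; Harish-Chandra 1953, Cor. to Thm. 2) and
`cuspidal_closure_irreducible` (closed invariant subspaces of `Cl[W]` are `⊥` or contain `[W]`;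
Harish-Chandra 1953, Thm. 5). Here the ELEMENTARY parts of both are proved, using the
`L²`-differentiability of the orbits of bounded cusp forms (`AutomorphicFormsL2Derivative`:
`t⁻¹ (R(exp tX)[f] - [f]) → [X f]` by the mean value bound and dominated convergence) and the
abstract closure theorem (`OneParameterClosureInvariant`: Taylor expansion, identity principle,
double orthogonal complement), leaving as named facts only the two genuinely analytic statements:

1. `AutomorphicRepsGL.cuspidal_closure_exists_mem_l2OfForms hcpt μ` (**named fact; the
   `K`-finite half of Harish-Chandra's Thm. 5**): a non-zero closed invariant subspace of
   `Cl[W]` (`W` irreducible) contains a non-zero class of an element of `W` — density of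
   `K`-finite vectors (Harish-Chandra 1953, Thms. 4 and 6; Getz–Hahn Prop. 4.4.2, Lemma 9.8.2)
   and `Cl(V') ∩ U' = V'` for the admissible `W` (Harish-Chandra Thm. 5; Libine Lemma 74;
   admissibility by Harish-Chandra's finiteness theorem, Getz–Hahn Thm. 6.1, Borel–Jacquet
   4.3 (i)). PROVED from it and `cuspidal_bounded`: `cuspidal_closure_irreducible hcpt μ`
   (`cuspidal_closure_irreducible_of`), through `exists_isStableSubmodule_toLp_mem`: the elements
   of a stable `W ≤ 𝒜₀^{A_G}` whose classes lie in a closed invariant `Q` form a STABLE subspace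
   `W_Q` — the Lie-derivative clause being `[X φ] = lim t⁻¹ (R(exp tX)[φ] - [φ]) ∈ Q`
   (`toLp_mem_closedSubrep_of_lieDeriv`) — so `W_Q = W` by irreducibility once it is non-zero.
2. `AutomorphicRepsGL.cuspidal_analyticAt_rightRegular hcpt μ` (**named fact; well-behavedness
   of `K`-finite `Z(𝔤)`-finite cusp forms**): for `[f] ∈ [W]` (`W` stable in `𝒜₀^{A_G}`) and
   `X ∈ 𝔤` the orbit `t ↦ R(exp tX)[f]` is real analytic (Harish-Chandra 1953, §7, Lemma 34,
   Thm. 6; Libine 2012, Thm. 72; Getz–Hahn, proof of Thm. 6.5.1 with Cor. 9.1.2). PROVED from it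
   and `cuspidal_bounded`: `cuspidal_closure_exp_invariant hcpt μ`
   (`cuspidal_closure_exp_invariant_of_analytic`) — Harish-Chandra's Corollary to Thm. 2 in this
   setting: `U t = R(exp tX)` is a one-parameter group of continuous linear maps of `L²`, every
   class in `[W]` has derivative `[X φ] ∈ [W]` along it (`tendsto_slope_rightRegular_toLp`), and
   `topologicalClosure_invariant_of_analyticAt` applies.
3. `AutomorphicRepsGL.exists_le_formsOfL2_of_W'_eq_bot_of_analytic` (**proved**): the target
   over `{cuspidal_bounded, cuspidal_analyticAt_rightRegular, cuspidal_closure_exists_mem_l2OfForms}`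
   (the named fact `mem_automorphicForms_iff` consumed by the first layer is now the theorem
   `mem_automorphicForms_iff_gl` of `AutomorphicFormsSpan`); `exists_isAssociatedL2_of_analytic`;
   `formsOfL2_closure_exp_invariant_of_analytic`: Step 3a of `AutomorphicRepsGLCuspidalL2Step3`
   over `{cuspidal_bounded, cuspidal_analyticAt_rightRegular}`.

## Design notes

* 2. is stated orbit-wise (`AnalyticAt ℝ` of `t ↦ R(exp tX)[f]` at every `t₀`, as a map into
  `L²`), which is what the closure argument consumes; Harish-Chandra's well-behavedness (joint
  analyticity on `G_∞`) implies it. 1. keeps the hypotheses of `cuspidal_closure_irreducible`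
  (irreducible `W`, where admissibility is available in print) and weakens its conclusion to the
  existence of one non-zero class, the rest being proved.
* Real scalars act on `L² = Lp ℂ 2 μ` through Mathlib's `Lp.instNormedSpace` (as in
  `AutomorphicFormsL2Derivative`); the abstract theorem of `OneParameterClosureInvariant` takes
  the real structure as a separate instance for this reason.
* No definition besides the two named facts; no instance; no `sorry`. (H5) `open scoped
  Classical`.

## References

* Harish-Chandra, *Representations of a semisimple Lie group on a Banach space. I*, Trans. AMS 75
  (1953), 185–243 (held): §7 and Cor. to Thm. 2 (pp. 209–211), Lemma 34, Thm. 5 and its proof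
  (pp. 228–229), Thm. 6 (p. 230) [HarishChandraTAMS1953].
* M. Libine, *Introduction to Representations of Real Semisimple Lie Groups*, arXiv:1212.2578
  (held): Thm. 72, Cor. 73, Lemma 74, Cor. 75 [Libine2012].
* J. R. Getz, H. Hahn, *An Introduction to Automorphic Representations*, GTM 300 (2024) (held):
  Prop. 4.4.2, Def. 4.5, Thm. 6.1, Thm. 6.5.1 and its proof (p. 192), Cor. 9.1.2, Thm. 9.8.1,
  Lemma 9.8.2 [GetzHahn2024].
* A. Borel, H. Jacquet, *Automorphic forms and automorphic representations*, Proc. Sympos. Pure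
  Math. 33 (1979), Part 1, §4.3–4.6 [BorelJacquetCorvallis1979].
-/

open scoped MatrixGroups Matrix ContDiff Classical Topology InnerProductSpace
open NumberField NumberField.mixedEmbedding IsDedekindDomain Filter
open _root_.MeasureTheory

noncomputable section

namespace Literature.NumberTheory.Automorphic

/-! ### 1. The `K`-finite direction: stability of `W_Q` under the Lie derivatives is proved -/

section KFinite

variable {n : ℕ} {K : Type} [Field K] [NumberField K]
  {hcpt : isCompact_glFiniteIntegralLevel n K}
  {μ : Measure (AdelicGroupData.gl n K).automorphicQuotient}
  [(AdelicGroupData.gl n K).IsAutomorphicMeasure μ]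

variable (hcpt μ) in
/-- **Non-zero closed invariant subspaces of `Cl[W]` meet `[W]`** (the `K`-finite half of
Harish-Chandra's correspondence, for irreducible spaces of cusp forms on `GL_n`). Let `W` be an
irreducible `(𝔤, K_∞) × GL_n(𝔸_K^∞)`-stable space of `A_G`-invariant cusp forms (a cuspidal
datum `W / ⊥`) and `[W] = l2OfForms W` its classes in `L²(GL_n(𝔸_K) ⧸ A_G GL_n(K), μ)`. Then
every non-zero closed `GL_n(𝔸_K)`-invariant subspace `Q` of `L²` contained in `Cl[W]` contains
a non-zero element of `[W]`. In print: the `K_∞ × U`-finite vectors of the unitary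
representation `Q ≠ 0` are dense, in particular non-zero ones exist (Harish-Chandra 1953,
Thm. 4 and Thm. 6; Getz–Hahn 2024, Prop. 4.4.2 and Lemma 9.8.2); `W` is admissible — it is
annihilated by an ideal of finite codimension of `Z(𝔤)`, Harish-Chandra's finiteness theorem
(Getz–Hahn Thm. 6.1; Borel–Jacquet 1979, 4.3 (i), 4.5) — so a vector of `Cl[W]` of a given
`K_∞ × U`-type lies in the closure of the finite-dimensional, hence closed, space of classes of
elements of `W` of that type: `Cl(V') ∩ U' = V'` (Harish-Chandra 1953, Thm. 5, pp. 228–229;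
Libine 2012, Lemma 74, `(W̄)_fini = W`). Not proved here. [cite: HarishChandraTAMS1953, Thm. 5 (pp. 228–229) and Thm. 6] -/
def AutomorphicRepsGL.cuspidal_closure_exists_mem_l2OfForms : Prop :=
  ∀ π : CuspidalAutomorphicRepData n K hcpt, π.1.W' = ⊥ →
    (∀ φ ∈ π.1.W, ∀ z ∈ (AdelicGroupData.gl n K).center', ∀ g, φ (z * g) = φ g) →
      ∀ Q : ContRepresentation.ClosedSubrep ((AdelicGroupData.gl n K).rightRegular μ),
        Q.toSubmodule ≤ (l2OfForms (AdelicGroupData.gl n K) μ π.1.W).topologicalClosure →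
          Q ≠ ⊥ → ∃ x ∈ l2OfForms (AdelicGroupData.gl n K) μ π.1.W, x ≠ 0 ∧ x ∈ Q

/-- **The elements of a stable space of `A_G`-invariant cusp forms whose classes lie in a closed
invariant subspace `Q` form a stable subspace**, granted boundedness (`cuspidal_bounded hcpt`).
For `W` stable in `𝒜₀` with `A_G`-invariant elements and `Q` a closed `GL_n(𝔸_K)`-invariant
subspace of `L²(μ)`, the set `W_Q` of `φ ∈ W` of the form `invQuot f`, `f ∈ ℒ²(μ)`, `[f] ∈ Q`,
is a subspace stable under `GL_n(𝔸_K^∞)`, `K_∞` (the class of a translate is the translate of the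
class, `Q` is invariant) and under the Lie derivatives: `X φ ∈ W` is bounded, so it is
`invQuot f_X` with `f_X ∈ ℒ²` (`exists_toLp_mem_cuspidalSubspace_of_bounded`) and
`[f_X] = lim t⁻¹ (R(exp tX)[f] - [f]) ∈ Q` (`toLp_mem_closedSubrep_of_lieDeriv` of
`AutomorphicFormsL2Derivative`: mean value bound and dominated convergence). This is the step
"`π_W(X) ψ = lim t⁻¹ {π(exp tX) ψ - ψ} ∈ V ∩ U'` since `V` is closed" of the proof of
Harish-Chandra 1953, Thm. 5 (p. 229). [cite: HarishChandraTAMS1953, Thm. 5 (proof, p. 229)] -/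
theorem AutomorphicRepsGL.exists_isStableSubmodule_toLp_mem (hb : AutomorphicRepsGL.cuspidal_bounded hcpt)
    {W : Submodule ℂ ((AdelicGroupData.gl n K).Adelic → ℂ)}
    (hW : IsStableSubmodule (AutomorphyDatum.gl n K hcpt) W) (hWc : W ≤ cuspFormsGL n K hcpt)
    (hWA : ∀ φ ∈ W, ∀ z ∈ (AdelicGroupData.gl n K).center', ∀ g, φ (z * g) = φ g)
    (Q : ContRepresentation.ClosedSubrep ((AdelicGroupData.gl n K).rightRegular μ)) :
    ∃ W_Q : Submodule ℂ ((AdelicGroupData.gl n K).Adelic → ℂ),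
      IsStableSubmodule (AutomorphyDatum.gl n K hcpt) W_Q ∧
        ∀ φ, φ ∈ W_Q ↔ φ ∈ W ∧ ∃ (f : (AdelicGroupData.gl n K).automorphicQuotient → ℂ)
          (hf : MemLp f 2 μ), invQuot (AdelicGroupData.gl n K) f = φ ∧ hf.toLp f ∈ Q := by
  -- the subspace `W_Q`
  let W_Q : Submodule ℂ ((AdelicGroupData.gl n K).Adelic → ℂ) :=
    { carrier := {φ | φ ∈ W ∧ ∃ (f : (AdelicGroupData.gl n K).automorphicQuotient → ℂ)
        (hf : MemLp f 2 μ), invQuot (AdelicGroupData.gl n K) f = φ ∧ hf.toLp f ∈ Q}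
      zero_mem' := ⟨W.zero_mem, 0, MemLp.zero, rfl, by
        rw [MemLp.toLp_zero]; exact Q.toSubmodule.zero_mem⟩
      add_mem' := by
        rintro _ _ ⟨hφ, f, hf, rfl, hfQ⟩ ⟨hψ, g, hg, rfl, hgQ⟩
        refine ⟨W.add_mem hφ hψ, f + g, hf.add hg, rfl, ?_⟩
        rw [MemLp.toLp_add hf hg]
        exact Q.toSubmodule.add_mem hfQ hgQ
      smul_mem' := by
        rintro c _ ⟨hφ, f, hf, rfl, hfQ⟩
        refine ⟨W.smul_mem c hφ, c • f, hf.const_smul c, rfl, ?_⟩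
        rw [MemLp.toLp_const_smul c hf]
        exact Q.toSubmodule.smul_mem c hfQ }
  -- translates: the class of a translate is the translate of the class
  have htrans : ∀ y : (AdelicGroupData.gl n K).Adelic,
      W ≤ W.comap (rightTranslation (AdelicGroupData.gl n K) y) →
        W_Q ≤ W_Q.comap (rightTranslation (AdelicGroupData.gl n K) y) := by
    rintro y hy _ ⟨hφ, f, hf, rfl, hfQ⟩
    refine ⟨hy hφ, fun x ↦ f (y⁻¹ • x), hf.comp_measurePreserving (measurePreserving_smul y⁻¹ μ),
      invQuot_smul _ f y, ?_⟩
    have key : (AdelicGroupData.gl n K).rightRegular μ y (hf.toLp f) =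
        (hf.comp_measurePreserving (measurePreserving_smul y⁻¹ μ)).toLp (fun x ↦ f (y⁻¹ • x)) := by
      rw [AdelicGroupData.rightRegular_apply, DomMulAct.mk_smul_toLp]
    rw [← key]
    exact Q.apply_mem y hfQ
  refine ⟨W_Q, ⟨fun φ hφ ↦ hW.le_automorphicForms hφ.1, fun y hy ↦ htrans y (hW.finite_stable y hy),
    fun k ↦ htrans _ (hW.k_stable k), ?_⟩, fun φ ↦ Iff.rfl⟩
  -- Lie derivatives: boundedness of `X φ ∈ W` and the `L²`-limit of the difference quotients
  rintro X _ ⟨hφ, f, hf, rfl, hfQ⟩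
  have hXφ : lieDeriv (AutomorphyDatum.gl n K hcpt).ofArch X (invQuot (AdelicGroupData.gl n K) f) ∈ W :=
    hW.lie_stable X _ hφ
  obtain ⟨f_X, hfX, -, hfXeq, -⟩ :=
    AutomorphicRepsGL.exists_toLp_mem_cuspidalSubspace_of_bounded (μ := μ) (hWc hXφ)
      (hWA _ hXφ) (hb _ (hWc hXφ) (hWA _ hXφ))
  obtain ⟨C, hC⟩ := hb _ (hWc hXφ) (hWA _ hXφ)
  refine ⟨hXφ, f_X, hfX, hfXeq, ?_⟩
  exact toLp_mem_closedSubrep_of_lieDeriv (AutomorphyDatum.gl n K hcpt) hf hfX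
    (automorphicForms_le_archSmooth _ (hW.le_automorphicForms hφ)) X hfXeq.symm (C := C)
    (fun g ↦ by rw [hfXeq]; exact hC g) Q hfQ

/-- **Harish-Chandra's correspondence from its `K`-finite half.** Boundedness
(`cuspidal_bounded hcpt`) and `cuspidal_closure_exists_mem_l2OfForms hcpt μ` imply
`cuspidal_closure_irreducible hcpt μ`: for an irreducible stable `W` of `A_G`-invariant cusp
forms and a non-zero closed invariant `Q ≤ Cl[W]`, the space `W_Q` of elements of `W` whose
classes lie in `Q` is stable (`exists_isStableSubmodule_toLp_mem`) and non-zero (it contains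
the inversion of a non-zero class in `Q ∩ [W]`), hence equal to `W` by irreducibility, so
`[W] ≤ Q` (the class map is injective, `invQuot_injective`). Harish-Chandra 1953, Thm. 5;
Libine 2012, Lemma 74 and Cor. 75. [cite: HarishChandraTAMS1953, Thm. 5 (pp. 228–229)] -/
theorem AutomorphicRepsGL.cuspidal_closure_irreducible_of
    (hb : AutomorphicRepsGL.cuspidal_bounded hcpt)
    (h : AutomorphicRepsGL.cuspidal_closure_exists_mem_l2OfForms hcpt μ) :
    AutomorphicRepsGL.cuspidal_closure_irreducible hcpt μ := by
  intro π hbot hπ Q hQ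
  by_cases hQ0 : Q = ⊥
  · exact Or.inl hQ0
  right
  obtain ⟨W_Q, hst, hmem⟩ :=
    AutomorphicRepsGL.exists_isStableSubmodule_toLp_mem (μ := μ) hb π.1.stable π.2 hπ Q
  have hle : W_Q ≤ π.1.W := fun φ hφ ↦ ((hmem φ).mp hφ).1
  -- `W_Q ≠ ⊥`: it contains the inversion of a non-zero class of `Q ∩ [W]`
  obtain ⟨x, ⟨f, hf, rfl, hfW⟩, hx0, hxQ⟩ := h π hbot hπ Q hQ hQ0
  have hfWQ : invQuot (AdelicGroupData.gl n K) f ∈ W_Q := (hmem _).mpr ⟨hfW, f, hf, rfl, hxQ⟩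
  have hne : W_Q ≠ ⊥ := by
    intro h0
    rw [h0, Submodule.mem_bot] at hfWQ
    apply hx0
    have hf0 : f = 0 := invQuot_injective _ (hfWQ.trans rfl)
    subst hf0
    exact MemLp.toLp_zero _
  -- hence `W_Q = W` by irreducibility of `W / ⊥`
  have hWQ : W_Q = π.1.W := by
    rcases π.1.irreducible W_Q (hbot ▸ bot_le) hle hst with h' | h'
    · exact absurd (h'.trans hbot) hne
    · exact h'
  -- and `[W] ≤ Q`
  rintro y ⟨f', hf', rfl, hf'W⟩
  rw [← hWQ] at hf'W
  obtain ⟨-, f, hf, hff', hfQ⟩ := (hmem _).mp hf'W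
  obtain rfl : f = f' := invQuot_injective _ hff'
  exact hfQ

/-- **The target over the refined base**: `cuspidal_bounded hcpt`,
`cuspidal_closure_exp_invariant hcpt μ` and `cuspidal_closure_exists_mem_l2OfForms hcpt μ` imply
`exists_le_formsOfL2_of_W'_eq_bot hcpt μ` (`exists_le_formsOfL2_of_W'_eq_bot_of_HC` with
`cuspidal_closure_irreducible_of`; the hypothesis `mem_automorphicForms_iff` of that theorem is
now the theorem `mem_automorphicForms_iff_gl` of `AutomorphicFormsSpan`). Borel–Jacquet 1979,
4.6; Harish-Chandra 1953, Thm. 5. [cite: BorelJacquetCorvallis1979, 4.6] -/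
theorem AutomorphicRepsGL.exists_le_formsOfL2_of_W'_eq_bot_of_HC'
    (h₁ : AutomorphicRepsGL.cuspidal_bounded hcpt)
    (h₂ : AutomorphicRepsGL.cuspidal_closure_exp_invariant hcpt μ)
    (h₃ : AutomorphicRepsGL.cuspidal_closure_exists_mem_l2OfForms hcpt μ) :
    AutomorphicRepsGL.exists_le_formsOfL2_of_W'_eq_bot hcpt μ :=
  AutomorphicRepsGL.exists_le_formsOfL2_of_W'_eq_bot_of_HC (mem_automorphicForms_iff_gl hcpt) h₁ h₂
    (AutomorphicRepsGL.cuspidal_closure_irreducible_of h₁ h₃)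

end KFinite

/-! ### 2. The closure direction: closure invariance from the analyticity of the orbits is proved -/

section Analytic

variable {n : ℕ} {K : Type} [Field K] [NumberField K]
  {hcpt : isCompact_glFiniteIntegralLevel n K}
  {μ : Measure (AdelicGroupData.gl n K).automorphicQuotient}
  [(AdelicGroupData.gl n K).IsAutomorphicMeasure μ]

variable (hcpt μ) in
/-- **Classes of `A_G`-invariant cusp forms are analytic vectors along the one-parameter
subgroups** (Harish-Chandra's well-behavedness). Let `W` be a `(𝔤, K_∞) × GL_n(𝔸_K^∞)`-stable
space of cusp forms on `GL_n(𝔸_K)` with `A_G`-invariant elements, `f ∈ ℒ²(μ)` with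
`invQuot f ∈ W`, and `X ∈ 𝔤 = 𝔤𝔩_n(K_∞)`. Then the orbit map `t ↦ R(exp tX) [f]` of the class of
`f` under the one-parameter subgroup of `X` is real analytic on `ℝ` (as a map into
`L²(GL_n(𝔸_K) ⧸ A_G GL_n(K), μ)`). In print: `[f]` is a `K`-finite, `Z(𝔤)`-finite vector of
`L²_cusp`, lying in the sum of finitely many irreducible summands `L²_cusp(π)` (Getz–Hahn 2024,
Thm. 9.8.1 and the proof of Thm. 6.5.1, p. 192, with Cor. 9.1.2 and Thm. 6.1: the `K`-finite
vectors of `L²_cusp(π)` are `𝒜^{A_G}_cusp ∩ L²_cusp(π)`, each `π` admissible), hence a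
well-behaved vector — `x ↦ π(x)[f]` is analytic on `G_∞` (Harish-Chandra 1953, §7 and Lemma 34,
p. 228; Thm. 6; Libine 2012, Thm. 72: `K`-finite vectors of admissible representations are
analytic, by elliptic regularity for `Ω_G - 2Ω_K`) — and in particular along `t ↦ exp tX`.
Not proved here. [cite: HarishChandraTAMS1953, §7 and Lemma 34 (p. 228)] -/
def AutomorphicRepsGL.cuspidal_analyticAt_rightRegular : Prop :=
  ∀ W : Submodule ℂ ((AdelicGroupData.gl n K).Adelic → ℂ),
    IsStableSubmodule (AutomorphyDatum.gl n K hcpt) W → W ≤ cuspFormsGL n K hcpt →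
      (∀ φ ∈ W, ∀ z ∈ (AdelicGroupData.gl n K).center', ∀ g, φ (z * g) = φ g) →
        ∀ (X : (AutomorphyDatum.gl n K hcpt).arch.lie)
          (f : (AdelicGroupData.gl n K).automorphicQuotient → ℂ) (hf : MemLp f 2 μ),
          invQuot (AdelicGroupData.gl n K) f ∈ W → ∀ t₀ : ℝ,
            AnalyticAt ℝ (fun t : ℝ ↦ (AdelicGroupData.gl n K).rightRegular μ
              ((AutomorphyDatum.gl n K hcpt).ofArch ((AutomorphyDatum.gl n K hcpt).arch.expMem (t • X)))
                (hf.toLp f)) t₀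

/-- **Harish-Chandra's closure theorem from the analyticity of the orbits** (Cor. to Thm. 2 of
Harish-Chandra 1953, p. 211, in the present setting). Boundedness (`cuspidal_bounded hcpt`) and
`cuspidal_analyticAt_rightRegular hcpt μ` imply `cuspidal_closure_exp_invariant hcpt μ`: with
`U t = R(exp tX)` (a one-parameter group of continuous linear maps of `L²`) and `S = [W]`, every
`[f] ∈ S` has `L²`-derivative `[f_X] ∈ S` along `U` (`X (invQuot f) ∈ W` is bounded, hence
`invQuot f_X` with `f_X ∈ ℒ²`; `tendsto_slope_rightRegular_toLp`) and an analytic orbit, so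
`U t` preserves `Cl S` (`topologicalClosure_invariant_of_analyticAt`: for `u ⊥ Cl S` the analytic
function `t ↦ ⟪u, U t [f]⟫` has all derivatives `⟪u, [X^k f]⟫ = 0` at `0`, hence vanishes, and
`(Cl S)ᗮᗮ = Cl S`). [cite: HarishChandraTAMS1953, Cor. to Thm. 2 (p. 211)] -/
theorem AutomorphicRepsGL.cuspidal_closure_exp_invariant_of_analytic
    (hb : AutomorphicRepsGL.cuspidal_bounded hcpt)
    (ha : AutomorphicRepsGL.cuspidal_analyticAt_rightRegular hcpt μ) :
    AutomorphicRepsGL.cuspidal_closure_exp_invariant hcpt μ := by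
  intro W hW hWc hWA X y hy
  -- the one-parameter group `U t = R(exp tX)` of continuous linear maps of `L²`
  let U : ℝ → ((AdelicGroupData.gl n K).L2 μ →L[ℂ] (AdelicGroupData.gl n K).L2 μ) := fun t ↦
    (AdelicGroupData.gl n K).rightRegular μ
      ((AutomorphyDatum.gl n K hcpt).ofArch ((AutomorphyDatum.gl n K hcpt).arch.expMem (t • X)))
  have hU : ∀ s t v, U (s + t) v = U s (U t v) := by
    intro s t v
    simp only [U, RealMatrixGroup.expMem_add_smul, map_mul]
    rfl
  have hU0 : ∀ v, U 0 v = v := by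
    intro v
    simp only [U, RealMatrixGroup.expMem_zero_smul, map_one]
    rfl
  -- every class of `W` has its `L²`-derivative along `U` in `[W]`
  have hS : ∀ v ∈ l2OfForms (AdelicGroupData.gl n K) μ W, ∃ v' ∈ l2OfForms (AdelicGroupData.gl n K) μ W,
      HasDerivAt (fun t ↦ U t v) v' 0 := by
    rintro _ ⟨f, hf, rfl, hfW⟩
    have hXφ : lieDeriv (AutomorphyDatum.gl n K hcpt).ofArch X (invQuot (AdelicGroupData.gl n K) f) ∈ W :=
      hW.lie_stable X _ hfW
    obtain ⟨f_X, hfX, -, hfXeq, -⟩ :=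
      AutomorphicRepsGL.exists_toLp_mem_cuspidalSubspace_of_bounded (μ := μ) (hWc hXφ)
        (hWA _ hXφ) (hb _ (hWc hXφ) (hWA _ hXφ))
    obtain ⟨C, hC⟩ := hb _ (hWc hXφ) (hWA _ hXφ)
    refine ⟨hfX.toLp f_X, toLp_mem_l2OfForms hfX (hfXeq ▸ hXφ), ?_⟩
    rw [hasDerivAt_iff_tendsto_slope_zero]
    have h := tendsto_slope_rightRegular_toLp (AutomorphyDatum.gl n K hcpt) hf hfX
      (automorphicForms_le_archSmooth _ (hW.le_automorphicForms hfW)) X hfXeq.symm (C := C)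
      (fun g ↦ by rw [hfXeq]; exact hC g)
    refine h.congr fun t ↦ ?_
    simp only [U, zero_add, hU0]
  -- analyticity of the orbits is the named fact
  have ha' : ∀ v ∈ l2OfForms (AdelicGroupData.gl n K) μ W, ∀ t₀ : ℝ,
      AnalyticAt ℝ (fun t ↦ U t v) t₀ := by
    rintro _ ⟨f, hf, rfl, hfW⟩ t₀
    exact ha W hW hWc hWA X f hf hfW t₀
  have h := topologicalClosure_invariant_of_analyticAt U hU hU0 _ hS ha' 1 y hy
  simpa only [U, one_smul] using h

/-- **The target over the analytic base.** `cuspidal_bounded hcpt` (Getz–Hahn Thm. 9.8.1),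
`cuspidal_analyticAt_rightRegular hcpt μ` (analytic orbits, Harish-Chandra's well-behavedness)
and `cuspidal_closure_exists_mem_l2OfForms hcpt μ` (the `K`-finite half of Harish-Chandra's
Thm. 5) imply `exists_le_formsOfL2_of_W'_eq_bot hcpt μ` — the realisation of irreducible spaces
of `A_G`-invariant cusp forms on `GL_n` in `L²_cusp` — everything else (Borel–Jacquet 4.3,
square-integrability, the closure theorem, the stability of `W_Q`, the lattice argument) being
proved. Borel–Jacquet 1979, 4.6; Harish-Chandra 1953, Cor. to Thm. 2 and Thm. 5. [cite: BorelJacquetCorvallis1979, 4.6] -/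
theorem AutomorphicRepsGL.exists_le_formsOfL2_of_W'_eq_bot_of_analytic
    (h₁ : AutomorphicRepsGL.cuspidal_bounded hcpt)
    (h₂ : AutomorphicRepsGL.cuspidal_analyticAt_rightRegular hcpt μ)
    (h₃ : AutomorphicRepsGL.cuspidal_closure_exists_mem_l2OfForms hcpt μ) :
    AutomorphicRepsGL.exists_le_formsOfL2_of_W'_eq_bot hcpt μ :=
  AutomorphicRepsGL.exists_le_formsOfL2_of_W'_eq_bot_of_HC (mem_automorphicForms_iff_gl hcpt) h₁
    (AutomorphicRepsGL.cuspidal_closure_exp_invariant_of_analytic h₁ h₂)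
    (AutomorphicRepsGL.cuspidal_closure_irreducible_of h₁ h₃)

/-- **`exists_isAssociatedL2` over the analytic base**: with semisimplicity
(`cuspidal_W'_eq_bot hcpt`) and the irreducibility of the `V_Π` (`formsOfL2_irreducible hcpt μ`),
the three analytic facts give the named fact `exists_isAssociatedL2 hcpt μ` of
`AutomorphicRepsGL` (`exists_isAssociatedL2_of_exists_le_formsOfL2`). Borel–Jacquet 1979,
4.4–4.6. [cite: BorelJacquetCorvallis1979, 4.4–4.6] -/
theorem AutomorphicRepsGL.exists_isAssociatedL2_of_analytic
    (hss : cuspidal_W'_eq_bot hcpt)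
    (h₁ : AutomorphicRepsGL.cuspidal_bounded hcpt)
    (h₂ : AutomorphicRepsGL.cuspidal_analyticAt_rightRegular hcpt μ)
    (h₃ : AutomorphicRepsGL.cuspidal_closure_exists_mem_l2OfForms hcpt μ)
    (h₄ : AutomorphicRepsGL.formsOfL2_irreducible hcpt μ) :
    AutomorphicRepsGL.exists_isAssociatedL2 hcpt μ :=
  AutomorphicRepsGL.exists_isAssociatedL2_of_exists_le_formsOfL2 hss
    (AutomorphicRepsGL.exists_le_formsOfL2_of_W'_eq_bot_of_analytic h₁ h₂ h₃) h₄

/-- Likewise Step 3a of `AutomorphicRepsGLCuspidalL2Step3` (`formsOfL2_closure_exp_invariant`)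
over boundedness and analyticity of the orbits. [cite: HarishChandraTAMS1953, Cor. to Thm. 2 (p. 211)] -/
theorem AutomorphicRepsGL.formsOfL2_closure_exp_invariant_of_analytic
    (h₁ : AutomorphicRepsGL.cuspidal_bounded hcpt)
    (h₂ : AutomorphicRepsGL.cuspidal_analyticAt_rightRegular hcpt μ) :
    AutomorphicRepsGL.formsOfL2_closure_exp_invariant hcpt μ :=
  AutomorphicRepsGL.formsOfL2_closure_exp_invariant_of_cuspidal
    (AutomorphicRepsGL.cuspidal_closure_exp_invariant_of_analytic h₁ h₂)

end Analytic

end Literature.NumberTheory.Automorphic
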